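import Literature.MathematicalPhysics.KineticTheory.LanfordAssembly
import Literature.MathematicalPhysics.KineticTheory.LanfordGCResummation
import HarnessLib

/-!
# Lanford's theorem reduced to its two physical inputs: the sectorwise iterated Duhamel formula
# and the term-by-term convergence

(Topic MathematicalPhysics/KineticTheory; the top of the bottom-up proof plan of the named fact
`Literature.MathematicalPhysics.KineticTheory.lanford` — **hilbert6.S02**, Lanford's theorem for hard
spheres on `T^d`, `Literature/MathematicalPhysics/KineticTheory/Sweep1.lean`. Theorems only: no
definition, no named fact. This file does NOT discharge `lanford`.)

`lanford_of_bbgkySide` (`LanfordAssembly`) proves `lanford` from one BBGKY-side hypothesis with four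
clauses on a family of functions `A_k^{(s),n}(t)`: measurability, majorants, the almost-everywhere
representation of the evolved correlation functions, and the term-by-term convergence to the
Boltzmann Duhamel terms. For THE candidates — the Duhamel terms `Q^ε_{s,s+n}(t) F_ε(0)` of the
grand-canonical BBGKY hierarchy along the regularised Alexander flows (`lanfordGCTerm`,
`LanfordGCHierarchy`) — the first two clauses are proved (`measurable_lanfordGCTerm`,
`abs_lanfordGCTerm_le`: CIP 1994 Thm 4.4.1 Step 3), and the third follows
(`tsum_lanfordGCTerm_ae_eq_correlationFn_gcEvolved_of_sectorwise`, `LanfordGCResummation`; flow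
independence `LanfordGCFlowIndependence`) from the **sectorwise iterated Duhamel formula** — for
every particle number `n`, the marginals of the evolved `n`-th sector of the Gibbs state are, almost
everywhere, the finite Duhamel series of the `n`-sphere hierarchy of its initial marginals (CIP 1994
(4.7) "for almost all `z^s`", App. 4.A–4.B; Illner–Pulvirenti 1987; Spohn 2006 Thm 11). Hence:

* `lanford_of_sectorwise_of_termwise` — **`lanford` follows from (S) the sectorwise iterated Duhamel
  formula for the Gibbs states of Lanford data (all `0 < ε < 1/2`, all `t ≥ 0`) and (C) the
  term-by-term convergence, in the sense of observables and locally uniformly off the diagonal, of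
  the grand-canonical Duhamel terms `Q^{ε_k}_{s,s+n}(t) F_{ε_k}(0)` to the Boltzmann Duhamel terms
  `Q⁰_{s,s+n}(t) f₀^{⊗(s+n)}` along every `ε_k → 0⁺`, on some horizon `T_c(d, β₀, C₀) > 0`
  (GST 2013 Part III, proof of Thm 8; CIP 1994 Thm 4.4.1 Step 1).** Both inputs are stated about
  objects of the tree with all their parameters; (S) is the input (S) of the BGSR programme
  (`bgsrMarginal_ae_abs_sub_blockComp_le`, `HardSphereHierarchyModel`) for Gibbs data, with the exact
  marginals as data; neither is the statement of `lanford` or a rewording of it.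

What remains for `lanford_holds` is exactly to prove (S) and (C).

## References

* C. Cercignani, R. Illner, M. Pulvirenti, *The Mathematical Theory of Dilute Gases*, Applied
  Mathematical Sciences 106, Springer (1994), §4.3 Thm 4.3.1, §4.4 (4.7) and Thm 4.4.1 (proof,
  Steps 1–4, pp. 77–86), App. 4.A–4.B (held:
  `lit read book:cercignani1994-mathematical-theory-dilute-gases`; bib key `CIP1994`).
* I. Gallagher, L. Saint-Raymond, B. Texier, *From Newton to Boltzmann* (2013) = arXiv:1208.5753
  (held text), Thms 6–8 (pp. 25–35), Ch. 18 §2 (proof of Thm 8, pp. 87–88) (bib key `GST2013`).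
* H. Spohn, *On the integrated form of the BBGKY hierarchy for hard spheres*,
  arXiv:math-ph/0605068, Thm 11.
-/

open MeasureTheory Metric Real Set Filter Topology Function
open scoped ENNReal

namespace Literature.MathematicalPhysics.KineticTheory

noncomputable section

open Literature.Analysis.FluidPDE

variable {d : Type*} [Fintype d]

/-- **Lanford's theorem from the sectorwise iterated Duhamel formula and the term-by-term
convergence** (CIP 1994 Thm 4.4.1; GST 2013 Thm 8). Assume
(S) for every `0 < ε < 1/2`, every Lanford datum `f₀` (`IsLanfordDatum β₀ C₀ f₀`, `β₀, C₀ > 0`),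
every `n`, `s ≤ n` and `t ≥ 0`: the `s`-marginal of the `n`-th sector of the Gibbs state
`gcInitial ε μ_ε f₀` evolved along the regularised Alexander flows equals a.e. the finite Duhamel
series of the `n`-sphere model `hsHierarchyModel` started from the marginals of that sector; and
(C) for all `d ≥ 2`, `β₀, C₀ > 0` there is `T_c > 0` such that for every Lanford datum `f₀`, every
`ε_k → 0⁺` (`ε_k < 1/2`), all `s, n`, every continuous compactly supported velocity observable `φ`,
every compact `K` off the diagonal and `δ > 0`, eventually in `k`, for all `t ∈ [0, T_c]` and
`x_s ∈ K`, the velocity averages of `Q^{ε_k}_{s,s+n}(t) F_{ε_k}(0)` (`lanfordGCTerm`) and of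
`Q⁰_{s,s+n}(t) f₀^{⊗(s+n)}` (`Kinetic.boltzmannDuhamelTerm`) at `x_s` differ by at most `δ`.
Then `lanford` holds — by `lanford_of_bbgkySide` with `A_k^{(s),n}(t) = Q^{ε_k}_{s,s+n}(t) F_{ε_k}(0)`,
majorants `(1 + e^{s-1}) max(C₀,1)^s 2^{-n} e^{-(β₀/2) E}` (`abs_lanfordGCTerm_le`) on
`T₁ = (√β₀)^{d+1}/(2 C'_d max(C₀, 1))`, the representation from (S)
(`tsum_lanfordGCTerm_ae_eq_correlationFn_gcEvolved_of_sectorwise`), and `T_B = min (T₁, T_c)`.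
[cite: CIP1994, §4.4 Thm 4.4.1, proof, Steps 1–4, pp. 77–86] -/
theorem lanford_of_sectorwise_of_termwise
    (hS : ∀ {ε : ℝ} (hε : 0 < ε) (hε' : ε < 2⁻¹) {β₀ C₀ : ℝ}, 0 < β₀ → 0 < C₀ →
      ∀ f₀ : UnitAddTorus d → EuclideanSpace ℝ d → ℝ, IsLanfordDatum β₀ C₀ f₀ →
        ∀ n, ∀ s ≤ n, ∀ t : ℝ, 0 ≤ t →
          nthMarginal n s (gcEvolved (fun N => Alexander.regHardSphereFlow (d := d) hε hε' N)
            (gcInitial (Torus.geometry d) ε (bgActivity d ε) (uncurry f₀)) t n) =ᵐ[volume]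
          (hsHierarchyModel (d := d) hε hε' n).seriesFamily n
            (fun k => nthMarginal n k (gcInitial (Torus.geometry d) ε (bgActivity d ε) (uncurry f₀) n)) s t)
    (hconv : ∀ (_hd : 2 ≤ Fintype.card d) {β₀ C₀ : ℝ}, 0 < β₀ → 0 < C₀ →
      ∃ T_c > (0 : ℝ), ∀ f₀ : UnitAddTorus d → EuclideanSpace ℝ d → ℝ, IsLanfordDatum β₀ C₀ f₀ →
        ∀ ε : ℕ → ℝ, (∀ k, 0 < ε k) → ∀ hε' : ∀ k, ε k < 2⁻¹, Tendsto ε atTop (𝓝 0) →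
          ∀ (s n : ℕ) (φ : (Fin s → EuclideanSpace ℝ d) → ℝ), Continuous φ → HasCompactSupport φ →
            ∀ K ⊆ offDiag (X := UnitAddTorus d) s, IsCompact K → ∀ δ > (0 : ℝ),
              ∀ᶠ k in atTop, ∀ t ∈ Icc 0 T_c, ∀ xs ∈ K,
                |velocityAverage φ (lanfordGCTerm (d := d) (hε' k) (uncurry f₀) n s t) xs -
                  velocityAverage φ (boltzmannDuhamelTerm (Torus.geometry d) n s t
                    (fun j => tensorPow j (uncurry f₀))) xs| ≤ δ) :
    lanford (d := d) := by
  refine lanford_of_bbgkySide fun hd β₀ C₀ hβ₀ hC₀ => ?_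
  haveI := isFiniteMeasure_sphereMeasure (E := EuclideanSpace ℝ d)
  obtain ⟨T_c, hT_c, hC⟩ := hconv hd hβ₀ hC₀
  -- the summation time of the grand-canonical series, uniform in `ε`
  obtain ⟨Cd, hCd⟩ : ∃ Cd : ℝ, Cd = (∫ u : EuclideanSpace ℝ d, (1 + ‖u‖) * exp (-(1 / 2) * ‖u‖ ^ 2)) *
      (KineticTheory.sphereMeasure : Measure (sphere (0 : EuclideanSpace ℝ d) 1)).real univ := ⟨_, rfl⟩
  have hJ : 0 ≤ ∫ u : EuclideanSpace ℝ d, (1 + ‖u‖) * exp (-(1 / 2) * ‖u‖ ^ 2) :=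
    integral_nonneg fun u => by positivity
  have hCd0 : 0 ≤ Cd := by rw [hCd]; exact mul_nonneg hJ measureReal_nonneg
  obtain ⟨Cst, hCst⟩ : ∃ Cst : ℝ, Cst = exp 2 * sqrt 2 ^ (Fintype.card d + 3) * Cd + 1 := ⟨_, rfl⟩
  have hCst0 : 0 < Cst := by rw [hCst]; positivity
  obtain ⟨N₁, hN₁⟩ : ∃ N₁ : ℝ, N₁ = max C₀ 1 := ⟨_, rfl⟩
  have hN₁0 : 0 < N₁ := by rw [hN₁]; exact lt_of_lt_of_le one_pos (le_max_right _ _)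
  have hsβ : 0 < sqrt β₀ ^ (Fintype.card d + 1) := pow_pos (sqrt_pos.2 hβ₀) _
  obtain ⟨T₁, hT₁⟩ : ∃ T₁ : ℝ, T₁ = sqrt β₀ ^ (Fintype.card d + 1) / (2 * Cst * N₁) := ⟨_, rfl⟩
  have hT₁0 : 0 < T₁ := by rw [hT₁]; positivity
  refine ⟨min T₁ T_c, lt_min hT₁0 hT_c, fun f₀ hf₀ ε hε hε' hε0 Φ => ?_⟩
  -- the uncurried datum
  have hf₀c : Continuous (uncurry f₀) := hf₀.2.1.1
  have hf₀m : Measurable (uncurry f₀) := hf₀c.measurable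
  have hf₀0 : 0 ≤ uncurry f₀ := fun z => hf₀.1 z.1 z.2
  have hf₀b : ∀ z : UnitAddTorus d × EuclideanSpace ℝ d, uncurry f₀ z ≤ C₀ * exp (-(β₀ / 2) * ‖z.2‖ ^ 2) :=
    fun z => (le_abs_self _).trans (abs_le_of_eGaussSupNorm_le hC₀.le hf₀.2.2 z.1 z.2)
  have hf₀i : Integrable (uncurry f₀) := by
    refine LanfordEmpirical.integrable_of_le_maxwellianBeta
      (C := C₀ * (2 * Real.pi * β₀⁻¹) ^ ((Module.finrank ℝ (EuclideanSpace ℝ d) : ℝ) / 2)) hβ₀ hf₀m hf₀0 fun z => ?_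
    have h := hf₀b z
    rw [LanfordEmpirical.exp_neg_eq_mul_maxwellianBeta hβ₀, ← mul_assoc] at h
    exact h
  -- the smallness condition on `[0, min T₁ T_c]`, for every `k`
  have hsmall : ∀ k, ∀ t ∈ Icc 0 (min T₁ T_c),
      2 * (exp 2 * sqrt 2 ^ (Fintype.card d + 3) * (gcHierarchyModel (d := d) (hε' k)).opConst + 1) *
        max C₀ 1 * t ≤ sqrt β₀ ^ (Fintype.card d + 1) := by
    intro k t ht
    have hopc : (gcHierarchyModel (d := d) (hε' k)).opConst = Cd := by rw [hCd]; rfl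
    rw [hopc, ← hCst, ← hN₁]
    have h1 : t ≤ T₁ := ht.2.trans (min_le_left _ _)
    rw [hT₁] at h1
    have h2 : 0 < 2 * Cst * N₁ := by positivity
    calc 2 * Cst * N₁ * t ≤ 2 * Cst * N₁ * (sqrt β₀ ^ (Fintype.card d + 1) / (2 * Cst * N₁)) := by gcongr
      _ = sqrt β₀ ^ (Fintype.card d + 1) := by field_simp
  -- the sectorwise formula on `[0, min T₁ T_c]`
  have hS' : ∀ k, ∀ n, ∀ s ≤ n, ∀ t ∈ Icc 0 (min T₁ T_c),
      nthMarginal n s (gcEvolved (fun N => Alexander.regHardSphereFlow (d := d) (hε k) (hε' k) N)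
        (gcInitial (Torus.geometry d) (ε k) (bgActivity d (ε k)) (uncurry f₀)) t n) =ᵐ[volume]
      (hsHierarchyModel (d := d) (hε k) (hε' k) n).seriesFamily n
        (fun j => nthMarginal n j (gcInitial (Torus.geometry d) (ε k) (bgActivity d (ε k)) (uncurry f₀) n)) s t :=
    fun k n s hs t ht => hS (hε k) (hε' k) hβ₀ hC₀ f₀ hf₀ n s hs t ht.1
  refine ⟨fun k s n t => lanfordGCTerm (d := d) (hε' k) (uncurry f₀) n s t,
    fun s => (1 + exp (s - 1 : ℝ)) * max C₀ 1 ^ s, 2⁻¹, β₀ / 2, by norm_num, by norm_num, half_pos hβ₀,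
    ?_, ?_, ?_, ?_⟩
  · exact fun k s n t ht => measurable_lanfordGCTerm (hε' k) (hε k).le hβ₀ hf₀m hf₀0 hf₀b n s ht.1
  · exact fun k s n t ht Z =>
      abs_lanfordGCTerm_le (hε' k) (hε k).le hβ₀ hC₀.le hf₀m hf₀0 hf₀b ht.1 (hsmall k t ht) n s Z
  · exact fun k s t ht =>
      tsum_lanfordGCTerm_ae_eq_correlationFn_gcEvolved_of_sectorwise (hε k) (hε' k) hβ₀ hC₀.le hf₀m hf₀0
        hf₀i hf₀b (hS' k) (Φ k) s ht (hsmall k t ht)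
  · intro s n φ hφ hφc K hK hKc δ hδ
    filter_upwards [hC f₀ hf₀ ε hε hε' hε0 s n φ hφ hφc K hK hKc δ hδ] with k hk t ht xs hxs
    exact hk t ⟨ht.1, ht.2.trans (min_le_right _ _)⟩ xs hxs

end

end Literature.MathematicalPhysics.KineticTheory
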